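import Mathlib
import HarnessLib
import Summits.NavierStokesRegularity.NavierStokesRegularity.Theorems.PoloidalWindowDoorLrcModEntireJetCertFast2

/-!
# Route `PoloidalWindowDoor`, item `LrcModEntire` (stmt-NavierStokesRegularity-20428) — certificate checker v3 + CANCELLATION nodes
# (Ritt–Thomas division by a non-vanishing initial / separant)

Cell ns-regularity-ideate, seat ns-poloidal-K2-p3 gen 7 (lead of item 20428; `--supports stmt-NavierStokesRegularity-20428`; definitions reviewed).
Triangular-decomposition engines (cert-1's `thomas.py`, Janet–Riquier completion) work, on the generic branch of a case split `π ≢ 0`, with the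
PSEUDO-REMAINDER: from a derived law `πᵏ·P ≡ 0` they continue with `P` itself and differentiate `P` further.  The trees of `…JetCertTree` /
`…JetCertFast2` (leaf / split) cannot express this without carrying the factor `πᵏ` through every later differentiation (degree blow-up).
This file adds the node and its soundness:

* `CertTreeC` — `leaf cert k e` / `split π nz z` as before, and `cancel cert k e P t`: the derivation `cert` from the current hypothesis laws
  yields, as its law number `k`, the polynomial `(Π pinsᵉ)·P` (checked after `normalizeS`); then `P` joins the hypothesis laws and `t` continues;
* `checkTreeC` — the Boolean checker (uses `…JetCertFast2.certCheckS`);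
* `localDatum_cancelS` — SOUNDNESS OF ONE CANCELLATION (also the chunked form, like `localDatum_extendS`): in a `LocalDatum` the pins are
  non-zero at the base point, hence (continuity of `x ↦ π(g x)`, `…JetCertTree.continuousAt_ev_comp`) on a neighbourhood; there `(Π pinsᵉ)·P ≡ 0`
  forces `P ≡ 0`, so `P` is a hypothesis law of a local datum on the shrunken open set (the `LocalDatum` quantifies its open set existentially);
* `not_localDatum_of_checkTreeC` — soundness of the whole tree (leaf / split cases verbatim from `…JetCertFast2.not_localDatum_of_checkTreeS`);
* `example_checkTreeC` — self-test by `decide +kernel`: letters `u, u′, u″`, laws `u·u′ = 0`, `u″ − u = 0`, pin `u`; cancel `u` from `u·u′`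
  ⇒ law `u′`; differentiate ⇒ `u″`; `−(u″−u) + u″ = u` = the pin.

WHAT THIS IS NOT: not a claim about Navier–Stokes — checker expressiveness (bears_on LADDER-NS N0, item 20428 `stub_localTHEmptyHyp`).
References: J. M. Thomas, *Differential Systems* (1937) §§7–9; Ritt, *Differential Algebra* (1950) Ch. I (remainders w.r.t. a chain:
`Π Iᵃ Sᵇ · F ≡ R`). [folklore]
-/

noncomputable section

-- the summit and its single sub-problem share the name (CONVENTIONS §1), as in every Theorems file
set_option linter.dupNamespace false

namespace Summit.NavierStokesRegularity.NavierStokesRegularity.Theorems.PoloidalWindowDoorLrcModEntireJetCertCancel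

open _root_.Topology _root_.Filter Set
open Literature.Analysis.ValidatedNumerics Literature.Analysis.ValidatedNumerics.QMvPoly
open Literature.Analysis.Calculus.MvPoly
open Summit.NavierStokesRegularity.NavierStokesRegularity.Theorems.PoloidalWindowDoorLrcModEntireJetCertDefs
open Summit.NavierStokesRegularity.NavierStokesRegularity.Theorems.PoloidalWindowDoorLrcModEntireJetCertMasked
open Summit.NavierStokesRegularity.NavierStokesRegularity.Theorems.PoloidalWindowDoorLrcModEntireJetCertTree
open Summit.NavierStokesRegularity.NavierStokesRegularity.Theorems.PoloidalWindowDoorLrcModEntireJetCertFast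
open Summit.NavierStokesRegularity.NavierStokesRegularity.Theorems.PoloidalWindowDoorLrcModEntireJetCertFast2

variable {E : Type*} [NormedAddCommGroup E] [NormedSpace ℝ E] {n : ℕ}

/-! ### Trees with cancellation nodes -/

/-- Certificate trees with CANCELLATION: `leaf cert k e` (the derivation's law `k` is the pin monomial `Π pinsᵉ`), `split π nz z` (case split on
`π ≢ 0` near the base point / `π ≡ 0` near it), `cancel cert k e P t` (the derivation's law `k` is `(Π pinsᵉ)·P`; continue `t` with the extra
hypothesis law `P`). [folklore] -/
inductive CertTreeC : Type
  | leaf : List (List (QMvPoly × ℕ × List ℕ)) → ℕ → List ℕ → CertTreeC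
  | split : QMvPoly → CertTreeC → CertTreeC → CertTreeC
  | cancel : List (List (QMvPoly × ℕ × List ℕ)) → ℕ → List ℕ → QMvPoly → CertTreeC → CertTreeC

/-- The Boolean checker for trees with cancellation (v3 interpreter `certCheckS` at leaves and cancellations). [folklore] -/
def checkTreeC (n : ℕ) (S : ℕ → ℕ → QMvPoly) (M : ℕ → ℕ → Bool) : List QMvPoly → List QMvPoly → CertTreeC → Bool
  | hyps, pins, .leaf cert k e => certCheckS n S M hyps cert k (pinProduct pins e)
  | hyps, pins, .split π nz z => checkTreeC n S M hyps (pins ++ [π]) nz && checkTreeC n S M (hyps ++ [π]) pins z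
  | hyps, pins, .cancel cert k e P t =>
      certCheckS n S M hyps cert k (QMvPoly.mul (pinProduct pins e) P) && checkTreeC n S M (hyps ++ [P]) pins t

/-! ### Soundness -/

/-- **SOUNDNESS OF ONE CANCELLATION (chunked form).**  If a derivation from the hypothesis laws of a local datum certifies the law
`(Π pinsᵉ)·P`, then `P` is a hypothesis law of a local datum with the same tables, directions and pins (on a smaller open set around the
same base point, where the pins do not vanish). [folklore] -/
theorem localDatum_cancelS {S : ℕ → ℕ → QMvPoly} {M : ℕ → ℕ → Bool} {v : ℕ → E} {hyps pins : List QMvPoly}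
    (hdat : LocalDatum n S M v hyps pins) {cert : List (List (QMvPoly × ℕ × List ℕ))} {k : ℕ} {e : List ℕ} {P : QMvPoly}
    (hcheck : certCheckS n S M hyps cert k (QMvPoly.mul (pinProduct pins e) P) = true) :
    LocalDatum n S M v (hyps ++ [P]) pins := by
  obtain ⟨U, p₀, g, hU, hp₀, hg, hS, hhyps, hpins⟩ := hdat
  -- the certified product law vanishes on `U`
  have hprod : ∀ x ∈ U, ev n (pinProduct pins e) (g x) * ev n P (g x) = 0 := by
    intro x hx
    rw [← ev_mul]
    exact ev_eq_zero_of_certCheckS hU hg hS hhyps hcheck x hx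
  -- the pin monomial is non-zero at `p₀`, hence on an open neighbourhood `V`
  have hne : ev n (pinProduct pins e) (g p₀) ≠ 0 := ev_pinProduct_ne_zero (g p₀) pins e hpins
  have hev : ∀ᶠ x in 𝓝 p₀, ev n (pinProduct pins e) (g x) ≠ 0 :=
    (continuousAt_ev_comp (hg p₀ hp₀) (pinProduct pins e)).eventually_ne hne
  obtain ⟨V, hVsub, hVo, hp₀V⟩ := mem_nhds_iff.1 hev
  refine ⟨U ∩ V, p₀, g, hU.inter hVo, ⟨hp₀, hp₀V⟩, fun x hx => hg x hx.1, fun j i hi x hx => hS j i hi x hx.1, ?_, hpins⟩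
  intro L hL x hx
  rcases List.mem_append.1 hL with h | h
  · exact hhyps L h x hx.1
  · rw [List.mem_singleton.1 h]
    have h1 := hprod x hx.1
    have h2 : ev n (pinProduct pins e) (g x) ≠ 0 := hVsub hx.2
    rcases mul_eq_zero.1 h1 with h0 | h0
    · exact absurd h0 h2
    · exact h0

/-- **SOUNDNESS OF CERTIFICATE TREES WITH CANCELLATION.**  A tree that checks refutes every local datum. [folklore] -/
theorem not_localDatum_of_checkTreeC {S : ℕ → ℕ → QMvPoly} {M : ℕ → ℕ → Bool} {v : ℕ → E} :
    ∀ (t : CertTreeC) (hyps pins : List QMvPoly), checkTreeC n S M hyps pins t = true → ¬ LocalDatum n S M v hyps pins := by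
  intro t
  induction t with
  | leaf cert k e =>
    intro hyps pins hcheck hdat
    obtain ⟨U, p₀, g, hU, hp₀, hg, hS, hhyps, hpins⟩ := hdat
    simp only [checkTreeC] at hcheck
    exact ev_pinProduct_ne_zero (g p₀) pins e hpins (ev_eq_zero_of_certCheckS hU hg hS hhyps hcheck p₀ hp₀)
  | split π nz z ihnz ihz =>
    intro hyps pins hcheck hdat
    simp only [checkTreeC, Bool.and_eq_true] at hcheck
    obtain ⟨hc1, hc2⟩ := hcheck
    obtain ⟨U, p₀, g, hU, hp₀, hg, hS, hhyps, hpins⟩ := hdat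
    by_cases hzero : ∃ V : Set E, IsOpen V ∧ p₀ ∈ V ∧ ∀ x ∈ V, ev n π (g x) = 0
    · obtain ⟨V, hV, hp₀V, hπ⟩ := hzero
      refine ihz (hyps ++ [π]) pins hc2 ⟨U ∩ V, p₀, g, hU.inter hV, ⟨hp₀, hp₀V⟩, fun x hx => hg x hx.1,
        fun j i hi x hx => hS j i hi x hx.1, ?_, hpins⟩
      intro L hL x hx
      rcases List.mem_append.1 hL with h | h
      · exact hhyps L h x hx.1
      · rw [List.mem_singleton.1 h]; exact hπ x hx.2
    · push Not at hzero
      set N : Set E := U ∩ ⋂ π' ∈ pins, {x | ev n π' (g x) ≠ 0} with hN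
      have hNnhds : N ∈ 𝓝 p₀ := by
        refine Filter.inter_mem (hU.mem_nhds hp₀) ?_
        refine (Filter.biInter_mem (List.finite_toSet pins)).2 fun π' hπ' => ?_
        exact (continuousAt_ev_comp (hg p₀ hp₀) π').eventually_ne (hpins π' hπ')
      obtain ⟨V, hVN, hVo, hp₀V⟩ := mem_nhds_iff.1 hNnhds
      obtain ⟨p₁, hp₁V, hp₁⟩ := hzero V hVo hp₀V
      have hp₁N : p₁ ∈ N := hVN hp₁V
      refine ihnz hyps (pins ++ [π]) hc1 ⟨U, p₁, g, hU, hp₁N.1, hg, hS, hhyps, ?_⟩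
      intro π' hπ'
      rcases List.mem_append.1 hπ' with h | h
      · exact (Set.mem_iInter₂.1 hp₁N.2) π' h
      · rw [List.mem_singleton.1 h]; exact hp₁
  | cancel cert k e P t ih =>
    intro hyps pins hcheck hdat
    simp only [checkTreeC, Bool.and_eq_true] at hcheck
    obtain ⟨hc1, hc2⟩ := hcheck
    exact ih (hyps ++ [P]) pins hc2 (localDatum_cancelS hdat hc1)

/-! ### Self-test (`decide +kernel`): cancel the pin `u` from the law `u·u′` -/

/-- The self-test tree with a cancellation node checks (letters `u, u′, u″`; laws `u·u′`, `u″ − u`; pin `u`). [folklore] -/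
theorem example_checkTreeC :
    checkTreeC 3 exampleTableM exampleMaskM
      [QMvPoly.mul (QMvPoly.var 3 0) (QMvPoly.var 3 1), QMvPoly.var 3 2 ++ QMvPoly.smul (-1) (QMvPoly.var 3 0)]
      [QMvPoly.var 3 0]
      (.cancel [] 0 [1] (QMvPoly.var 3 1)
        (.leaf [[(QMvPoly.const 1, 2, [0])], [(QMvPoly.const (-1), 1, []), (QMvPoly.const 1, 3, [])]] 4 [1])) = true := by
  decide +kernel

end Summit.NavierStokesRegularity.NavierStokesRegularity.Theorems.PoloidalWindowDoorLrcModEntireJetCertCancel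

end
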